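import Literature.NumberTheory.Sieve.IwaniecAlmostPrimesQuadraticLemma4
import HarnessLib

/-!
# Iwaniec (1978) for a general quadratic `G`: the Theorem from the root exponential sums and the
# dispersion argument — the two remaining printed steps, named

H. Iwaniec, *Almost-primes represented by quadratic polynomials*, Invent. Math. **47** (1978)
171–188 [IwaniecInventiones1978]; R. J. Lemke Oliver, *Almost-primes represented by quadratic
polynomials*, Acta Arith. **151** (2012) 241–261 [LemkeOliverActaArith2012] (the general-`G` proof
written out).  Companion of `IwaniecAlmostPrimes.lean` (the named fact `theorem_quadratic`:
Iwaniec's Theorem, p. 172, for every irreducible `G = aX² + bX + c` with `a > 0`, `c` odd, with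
the constant `1/77` of display (1)).

State of the inline proof in the tree (files `IwaniecAlmostPrimes*`, `IwaniecAlmostPrimesQuadratic*`):
the case `G = X² + 1` is PROVED end to end (`IwaniecAlmostPrimesHolds`), and for a general `G`
everything downstream of Proposition 1 is PROVED — `theorem_quadratic_of_proposition1G :
(∀ G, proposition1G G) → theorem_quadratic` (`IwaniecAlmostPrimesQuadraticProp1Corollary`: the
Corollary of Prop. 1, Prop. 2 from Iwaniec's bilinear sieve `lemma2_bilinearSieve_holds`, §6 and the
numerics for general `G`).  Upstream of Proposition 1 the general-`G` copies of the `n² + 1` files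
exist as theorems with the root exponential sum bound as a HYPOTHESIS (`rootExpSumBoundG a b c`,
`IwaniecAlmostPrimesQuadraticLemma4`: Lemma 4 for `𝒜_G` in relative form `lemma4_windowG`; the
linear model and the sums `U`, `V`, `W` of the dispersion, `IwaniecAlmostPrimesQuadraticVW`; the
dispersion identities, `IwaniecAlmostPrimesQuadraticDispersion`), while the bound itself is being
established through the correspondence roots ↔ binary quadratic forms
(`IwaniecAlmostPrimesQuadratic{RootsForms,FundDomain,Phase,SliceSumG}`).  The printed proof of
Proposition 1 (§4, pp. 176–185) therefore splits, for every `G`, into exactly two remaining steps,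
named here:

* `rootExpSumBound_general` — Iwaniec's estimate (11), p. 180 (Lemmas 5–6: Gauss–Lagrange
  correspondence and Hooley's bound for incomplete Kloosterman-type sums) for the Lemma-4 family of
  `𝒜_G`; for a general quadratic this is [LemkeOliverActaArith2012, Lemma 8 with (3.4)–(3.5)];
* `proposition1_of_rootExpSumBound_general` — the dispersion argument, §4 pp. 181–185 ((12)–(14):
  Lemma 4 ⟹ linear model ⟹ evaluation of `U`, `V`, `W` ⟹ Proposition 1), for a general quadratic
  [LemkeOliverActaArith2012, §2, (2.8)–(2.17)]; for `G = X² + 1` this is the tree's PROVED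
  `proposition1_of_lemma6` (`IwaniecAlmostPrimesProp1`);
* `theorem_quadratic_holds_of` — the assembly through `theorem_quadratic_of_proposition1G`.

## References

* [IwaniecInventiones1978] H. Iwaniec, Invent. Math. 47 (1978) 171–188: Theorem p. 172 ("the
  general case being similar"), §4 Proposition 1 and Corollary (p. 176), Lemma 4 (p. 177),
  Lemmas 5–7, (11) p. 180, (12)–(14) pp. 181–185.
* [LemkeOliverActaArith2012] R. J. Lemke Oliver, Acta Arith. 151 (2012) 241–261: Theorem 1, §2
  (2.8)–(2.17), Lemma 3, §3 Lemma 8, (3.4)–(3.5).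
-/

noncomputable section

open Finset Real Polynomial

namespace Literature.NumberTheory.Sieve.Iwaniec1978

/-- **Iwaniec 1978, (11) p. 180 / Lemke Oliver 2012, Lemma 8 with (3.5), for every admissible
`G`: the root exponential sums of Lemma 4 for `𝒜_G`.**  For every `G = aX² + bX + c ∈ ℤ[X]`
irreducible with `a > 0` and `c` odd, and every `ε > 0`, there are `C ≥ 0`, `K ≥ 1` such that for
`Q` squarefree, `q ∣ Q`, `d ∣ q`, `A ≥ 2`, all `B, μ, ω` and every integer `h ≠ 0`,
`|∑_{(m,Θ) ∈ lemma4FamilyG} e(hΘ/(mq))| ≤ C d K^{ω(Q)} τ(|h|) (3 + 8π|h|/(Aq)) S^{1/2+ε} S`,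
`S = ⌊√(Bq)⌋` — the predicate `rootExpSumBoundG a b c` of `IwaniecAlmostPrimesQuadraticLemma4`
(there a hypothesis with parameters), asserted for every admissible `G`.  Printed: Iwaniec proves
(11) for `G = X² + 1` (Lemma 5 = Gauss–Lagrange, Lemma 6 = Hooley's bound from Weil's, Lemma 7;
the tree's PROVED `norm_rootExpSum_le`, `rootExpSumBoundG_one_zero_one`) and states that the general
case is similar (p. 172); Lemke Oliver, §3, carries it out for a general irreducible quadratic
through the correspondence between roots of `G (mod m)` and representations by binary quadratic
forms of discriminant `b² − 4ac` (Lemma 8, (3.4)–(3.5)), with Hooley's treatment of the indefinite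
case.  In the tree the general-`G` engine is `IwaniecAlmostPrimesQuadraticRootsForms` /
`…FundDomain` / `…Phase` / `…SliceSumG` (`norm_sliceSumG_le`); the factor `K^{ω(Q)}` (instead of
`∑_{l∣Q} ρ(lq)`) is what its class counting produces.
[cite: IwaniecInventiones1978, §4 (11) pp. 180–181 with Lemmas 5–7]
[cite: LemkeOliverActaArith2012, Lemma 8 and (3.4)–(3.5)] -/
def rootExpSumBound_general : Prop :=
  ∀ a b c : ℤ, 0 < a → Odd c → Irreducible (quadPoly a b c) → rootExpSumBoundG a b c

/-- **Iwaniec 1978, §4 pp. 181–185 / Lemke Oliver 2012, §2: Proposition 1 for `𝒜_G` from the root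
exponential sums (the dispersion argument), for every admissible `G`.**  For every
`G = aX² + bX + c ∈ ℤ[X]` irreducible with `a > 0`, `c` odd: IF the root exponential sum bound
`rootExpSumBoundG a b c` holds, THEN Proposition 1 holds for `𝒜_G` (`proposition1G a b c`:
`∑_{M<m<2M} B(x; m, N)² ≪_{ε,G} (1 + N^{7/2} M^{−5/4} x) x^{1+ε}` for `|b_n| ≤ 1` supported on
squarefree `n`, `1 ≤ M < x`, `N ≥ 1`).  Printed route (Iwaniec pp. 181–185, for `n² + 1`, "the
general case being similar"; Lemke Oliver (2.8)–(2.17) for general `G`): Lemma 4 (equidistribution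
of the roots of `G(Ω) ≡ 0 (mod mq)`, from (11) by Erdős–Turán/Fejér) packaged as a linear model
for the window counts, the dispersion `𝒟 = W − 2xV + x²U` ((12)–(14)) and the cancellation of its
main terms.  In the tree every layer but the last is PROVED for general `G` from the hypothesis:
`lemma4_windowG` (`IwaniecAlmostPrimesQuadraticLemma4`), `windowCount_linearG`, `usum_linearG`,
`vsum_boundsG`, `wsum_boundsG` (`IwaniecAlmostPrimesQuadraticVW`), the identities of
`IwaniecAlmostPrimesQuadraticDispersion`; what remains is the final combination, the general-`G`
copy of `proposition1_of_lemma6` (`IwaniecAlmostPrimesProp1`, PROVED for `X² + 1`).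
[cite: IwaniecInventiones1978, §4 Proposition 1, pp. 181–185 (12)–(14)]
[cite: LemkeOliverActaArith2012, §2 (2.8)–(2.17)] -/
def proposition1_of_rootExpSumBound_general : Prop :=
  ∀ a b c : ℤ, 0 < a → Odd c → Irreducible (quadPoly a b c) →
    rootExpSumBoundG a b c → proposition1G a b c

/-- **Assembly: Iwaniec's Theorem for every admissible quadratic from the two remaining steps.**
Proposition 1 for each `𝒜_G` is `h₂ G (h₁ G)`, and `theorem_quadratic_of_proposition1G` (the
PROVED chain Corollary of Prop. 1 ⟹ Prop. 2 ⟹ §6 ⟹ display (1) with `1/77`, for general `G`)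
concludes. [cite: IwaniecInventiones1978, Theorem p. 172] -/
theorem theorem_quadratic_holds_of (h₁ : rootExpSumBound_general)
    (h₂ : proposition1_of_rootExpSumBound_general) : theorem_quadratic :=
  theorem_quadratic_of_proposition1G fun a b c ha hc hirr =>
    h₂ a b c ha hc hirr (h₁ a b c ha hc hirr)

end Literature.NumberTheory.Sieve.Iwaniec1978

end
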